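import Summits.ABC.ABC.Theorems.IneffectiveSubspaceDepthCountedABCStubCellZeroQuarticThue

/-!
# Stub `stub_cellOneCases` of line `Sketch` — crux `IneffectiveSubspace.DepthCountedABC` (stmt-ABC-14938)

THE ARITHMETIC INPUT OF THE CELL-1 CERTIFICATE (lead c19).  For an abc triple of the cell `#{p : v_p(abc) ≥ 5} ≤ 1`
ordered `a ≤ b`, let `p` be the deep prime (if any).  Exactly one of three things happens: (i) `p` meets neither `b`
nor `c` — then `bc` is 5-free, `c² ≤ 2bc ≤ 2rad⁴`, i.e. `c < 2rad(abc)²`; (ii) `p ∣ b` — then `a, c` are 5-free,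
`c = vZ⁴` (non-quartic part times the fourth power of the quartic support, `v ≤ E(c)³`, `E(c)·c = rad(c)⁴`) and
with `u = b/p^{v_p(b)}` the triple reads `a + p^k·u = v·Z⁴` with `a·u·v·p·c⁴ ≤ rad¹⁶` and `c⁴ ≤ rad¹²·Z⁴`
(from `a·u·p⁴·c ≤ rad⁴`, `E(c)·c ≤ rad⁴`, using `rad(b) = p·rad(u)`); (iii) `p ∣ c` — symmetrically `b = uY⁴`,
`a + u·Y⁴ = p^w·v` with `c ≤ 2b`, `a·u·v·p·b⁴ ≤ rad¹⁶`, `b⁴ ≤ rad¹²·Y⁴`.  Cases (ii)/(iii) are the binomial quartic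
THUE–MAHLER configurations of cell 1; the companion stub `stub_cellOneOfUniformQuarticThueMahler` turns a uniform bound
on them into the first improvement of the free exponent 4 on the cell.

Sources: skeleton `Cruxes/DepthCountedABC/Lines/Sketch.lean` (lead c19, stub `stub_cellOneCases`); lemmas
`quarticThue_split`, `quarticThue_low_le_defect_cube`, `quarticThue_defect_mul` (`…StubCellZeroQuarticThue`) and the
`stub_calibration` lemmas.  Mathlib only otherwise (`Nat.ordProj_mul_ordCompl_eq_self`, `Nat.not_dvd_ordCompl`,
`Nat.primeFactors_prime_pow`, `UniqueFactorizationMonoid.radical_mul`, `Finset.card_le_one`).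
-/

-- `Summit.<Summit>.<Problem>` is the mandated summit-side namespace (CONVENTIONS §2); for the
-- single-conjunct summit `ABC` the two coincide, so the duplicate `ABC.ABC` is deliberate.
set_option linter.dupNamespace false

namespace Summit.ABC.ABC.Theorems.DepthCountedABC

section CellOne
open UniqueFactorizationMonoid (radical)
open Literature.NumberTheory.DiophantineGeometry (IsABCTriple rad rad_def)

/-- The radical of `p^k · u` for a prime `p ∤ u` and `k ≠ 0` is `p · rad(u)` (in `ℕ`). [folklore] -/
theorem cellOne_radical_primePow_mul {p k u : ℕ} (hp : p.Prime) (hk : k ≠ 0) (hpu : ¬ p ∣ u) :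
    radical (p ^ k * u) = p * radical u := by
  have hcop : Nat.Coprime (p ^ k) u := Nat.Coprime.pow_left k ((Nat.Prime.coprime_iff_not_dvd hp).mpr hpu)
  rw [UniqueFactorizationMonoid.radical_mul (Nat.coprime_iff_isRelPrime.mp hcop),
    Nat.radical_eq_prod_primeFactors (n := p ^ k), Nat.primeFactors_prime_pow hk hp, Finset.prod_singleton]

/-- **Stub `stub_cellOneCases` (case analysis of the cell `ω₅ ≤ 1`) of line `Sketch`, crux `DepthCountedABC`
(stmt-ABC-14938):** for an abc triple of the cell ordered `a ≤ b`, either `c < 2·rad(abc)²`, or the deep prime sits in `b`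
(a Thue–Mahler configuration `a + p^k·u = v·Z⁴` with `a·u·v·p·c⁴ ≤ rad¹⁶`, `c⁴ ≤ rad¹²·Z⁴`), or it sits in `c`
(`a + u·Y⁴ = p^w·v` with `c ≤ 2b`, `a·u·v·p·b⁴ ≤ rad¹⁶`, `b⁴ ≤ rad¹²·Y⁴`). [folklore] -/
theorem stub_cellOneCases : ∀ a b c : ℕ, Literature.NumberTheory.DiophantineGeometry.IsABCTriple a b c → a ≤ b →
    ((a * b * c).primeFactors.filter (fun p => 5 ≤ (a * b * c).factorization p)).card ≤ 1 →
    (c < 2 * (Literature.NumberTheory.DiophantineGeometry.rad a b c) ^ 2 ∨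
    (∃ p k u v Z : ℕ, p.Prime ∧ 0 < u ∧ 0 < v ∧ 0 < Z ∧ a + p ^ k * u = v * Z ^ 4 ∧
      Nat.Coprime (p ^ k * u) (v * Z ^ 4) ∧ c = v * Z ^ 4 ∧
      a * u * v * p * c ^ 4 ≤ (Literature.NumberTheory.DiophantineGeometry.rad a b c) ^ 16 ∧
      c ^ 4 ≤ (Literature.NumberTheory.DiophantineGeometry.rad a b c) ^ 12 * Z ^ 4) ∨
    (∃ p w u v Y : ℕ, p.Prime ∧ 0 < u ∧ 0 < v ∧ 0 < Y ∧ a + u * Y ^ 4 = p ^ w * v ∧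
      Nat.Coprime (u * Y ^ 4) (p ^ w * v) ∧ b = u * Y ^ 4 ∧ c ≤ 2 * b ∧
      a * u * v * p * b ^ 4 ≤ (Literature.NumberTheory.DiophantineGeometry.rad a b c) ^ 16 ∧
      b ^ 4 ≤ (Literature.NumberTheory.DiophantineGeometry.rad a b c) ^ 12 * Y ^ 4)) := by
  intro a b c h hab hK
  obtain ⟨ha, hb, hsum, hcop⟩ := h
  have hc : 0 < c := by omega
  have hne : a * b * c ≠ 0 := by positivity
  have ha0 : a ≠ 0 := ha.ne'
  have hb0 : b ≠ 0 := hb.ne'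
  have hc0 : c ≠ 0 := hc.ne'
  have hac : Nat.Coprime a c := by rw [← hsum, Nat.coprime_self_add_right]; exact hcop
  have hbc : Nat.Coprime b c := by rw [← hsum, add_comm, Nat.coprime_self_add_right]; exact hcop.symm
  have hda : a ∣ a * b * c := dvd_mul_of_dvd_left (dvd_mul_right a b) c
  have hdb : b ∣ a * b * c := dvd_mul_of_dvd_left (dvd_mul_left b a) c
  have hdc : c ∣ a * b * c := dvd_mul_left c (a * b)
  have hc2b : c ≤ 2 * b := by omega
  set D := (a * b * c).primeFactors.filter (fun p => 5 ≤ (a * b * c).factorization p) with hD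
  set R := rad a b c with hR
  have hRdef : R = radical (a * b * c) := rad_def a b c
  have hR1 : 1 ≤ R := by rw [hRdef]; exact Nat.radical_pos _
  -- `rad a · rad b · rad c = R`
  have hRabc : radical a * radical b * radical c = R := by
    rw [hRdef, ← UniqueFactorizationMonoid.radical_mul (Nat.coprime_iff_isRelPrime.mp hcop),
      ← UniqueFactorizationMonoid.radical_mul (Nat.coprime_iff_isRelPrime.mp (Nat.Coprime.mul_left hac hbc))]
  -- a factor of `abc` met by no deep prime is 5-free
  have fiveFree : ∀ x : ℕ, x ∣ a * b * c → (∀ t ∈ D, ¬ t ∣ x) →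
      ∀ t ∈ x.primeFactors, x.factorization t ≤ 4 := by
    intro x hxd hxD t ht
    by_contra hlt
    push Not at hlt
    exact hxD t (calibration_mem_deep_of_factor hne hxd ht hlt) (Nat.dvd_of_mem_primeFactors ht)
  have shallow : ∀ x : ℕ, x ∣ a * b * c → (∀ t ∈ D, ¬ t ∣ x) → x ≤ (radical x) ^ 4 := by
    intro x hxd hxD
    have hx0 : x ≠ 0 := by rintro rfl; exact hne (zero_dvd_iff.mp hxd)
    exact calibration_le_radical_pow_of_factorization_le hx0 (fiveFree x hxd hxD)
  have hDprime : ∀ t ∈ D, t.Prime := fun t ht => Nat.prime_of_mem_primeFactors (Finset.mem_filter.mp ht).1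
  -- two members of `D` coincide
  have hDuniq : ∀ t ∈ D, ∀ t' ∈ D, t = t' := fun t ht t' ht' => Finset.card_le_one.mp hK t ht t' ht'
  by_cases hbD : ∃ t ∈ D, t ∣ b
  · -- the deep prime sits in `b`
    obtain ⟨p, hpD, hpb⟩ := hbD
    have hp : p.Prime := hDprime p hpD
    have haD : ∀ t ∈ D, ¬ t ∣ a := by
      intro t ht hta
      rw [hDuniq t ht p hpD] at hta
      exact hp.one_lt.ne' (Nat.Coprime.eq_one_of_dvd (Nat.Coprime.coprime_dvd_left hta hcop) hpb)
    have hcD : ∀ t ∈ D, ¬ t ∣ c := by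
      intro t ht htc
      rw [hDuniq t ht p hpD] at htc
      exact hp.one_lt.ne' (Nat.Coprime.eq_one_of_dvd (Nat.Coprime.coprime_dvd_left hpb hbc) htc)
    right; left
    set k := b.factorization p with hk
    set u := b / p ^ k with hu
    have hbu : p ^ k * u = b := Nat.ordProj_mul_ordCompl_eq_self b p
    have hk0 : k ≠ 0 := by
      rw [hk]; exact (Nat.Prime.factorization_pos_of_dvd hp hb0 hpb).ne'
    have hupos : 0 < u := Nat.ordCompl_pos p hb0
    have hud : u ∣ b := Nat.ordCompl_dvd b p
    have hpu : ¬ p ∣ u := Nat.not_dvd_ordCompl hp hb0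
    have huD : ∀ t ∈ D, ¬ t ∣ u := by
      intro t ht htu
      rw [hDuniq t ht p hpD] at htu
      exact hpu htu
    -- 5-free data
    have hc4 : ∀ t ∈ c.primeFactors, c.factorization t ≤ 4 := fiveFree c hdc hcD
    set v := ∏ q ∈ c.primeFactors.filter (fun q => ¬ c.factorization q = 4), q ^ c.factorization q with hv
    set Z := ∏ q ∈ c.primeFactors.filter (fun q => c.factorization q = 4), q with hZ
    set Ec := ∏ q ∈ c.primeFactors.filter (fun q => ¬ c.factorization q = 4), q ^ (4 - c.factorization q) with hEc
    have hcsplit : c = v * Z ^ 4 := quarticThue_split hc0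
    have hvle : v ≤ Ec ^ 3 := quarticThue_low_le_defect_cube hc4
    have hEcc : Ec * c = (radical c) ^ 4 := quarticThue_defect_mul hc0 hc4
    have hvpos : 0 < v := Finset.prod_pos fun q hq =>
      pow_pos (Nat.pos_of_mem_primeFactors (Finset.mem_filter.mp hq).1) _
    have hZpos : 0 < Z := Finset.prod_pos fun q hq => Nat.pos_of_mem_primeFactors (Finset.mem_filter.mp hq).1
    -- radicals
    have hradb : radical b = p * radical u := by rw [← hbu]; exact cellOne_radical_primePow_mul hp hk0 hpu
    have hale : a ≤ (radical a) ^ 4 := shallow a hda haD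
    have hule : u ≤ (radical u) ^ 4 := shallow u (hud.trans hdb) huD
    have hcle : c ≤ (radical c) ^ 4 := shallow c hdc hcD
    have hN1 : a * u * p ^ 4 * c ≤ R ^ 4 :=
      calc a * u * p ^ 4 * c ≤ (radical a) ^ 4 * (radical u) ^ 4 * p ^ 4 * (radical c) ^ 4 := by gcongr
        _ = (radical a * (p * radical u) * radical c) ^ 4 := by ring
        _ = R ^ 4 := by rw [← hradb, hRabc]
    have hN2 : Ec * c ≤ R ^ 4 := by
      have h1 : radical c ≤ R := by
        rw [← hRabc]
        calc radical c = 1 * radical c := (one_mul _).symm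
          _ ≤ (radical a * radical b) * radical c :=
              Nat.mul_le_mul_right _ (Nat.one_le_iff_ne_zero.mpr (by positivity))
      calc Ec * c = (radical c) ^ 4 := hEcc
        _ ≤ R ^ 4 := Nat.pow_le_pow_left h1 4
    refine ⟨p, k, u, v, Z, hp, hupos, hvpos, hZpos, ?_, ?_, hcsplit, ?_, ?_⟩
    · rw [hbu, ← hcsplit, hsum]
    · rw [hbu, ← hcsplit]; exact hbc
    · calc a * u * v * p * c ^ 4 ≤ a * u * Ec ^ 3 * p ^ 4 * c ^ 4 := by
            gcongr
            calc p = p ^ 1 := (pow_one p).symm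
              _ ≤ p ^ 4 := Nat.pow_le_pow_right hp.pos (by norm_num)
        _ = (a * u * p ^ 4 * c) * (Ec * c) ^ 3 := by ring
        _ ≤ R ^ 4 * (R ^ 4) ^ 3 := Nat.mul_le_mul hN1 (Nat.pow_le_pow_left hN2 3)
        _ = R ^ 16 := by ring
    · calc c ^ 4 = c ^ 3 * c := by ring
        _ = c ^ 3 * (v * Z ^ 4) := by rw [← hcsplit]
        _ = (v * c ^ 3) * Z ^ 4 := by ring
        _ ≤ (Ec * c) ^ 3 * Z ^ 4 := by
            apply Nat.mul_le_mul_right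
            calc v * c ^ 3 ≤ Ec ^ 3 * c ^ 3 := Nat.mul_le_mul_right _ hvle
              _ = (Ec * c) ^ 3 := by ring
        _ ≤ (R ^ 4) ^ 3 * Z ^ 4 := Nat.mul_le_mul_right _ (Nat.pow_le_pow_left hN2 3)
        _ = R ^ 12 * Z ^ 4 := by ring
  by_cases hcD : ∃ t ∈ D, t ∣ c
  · -- the deep prime sits in `c`
    push Not at hbD
    obtain ⟨p, hpD, hpc⟩ := hcD
    have hp : p.Prime := hDprime p hpD
    have haD : ∀ t ∈ D, ¬ t ∣ a := by
      intro t ht hta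
      rw [hDuniq t ht p hpD] at hta
      exact hp.one_lt.ne' (Nat.Coprime.eq_one_of_dvd (Nat.Coprime.coprime_dvd_left hta hac) hpc)
    right; right
    set w := c.factorization p with hw
    set v := c / p ^ w with hv
    have hcv : p ^ w * v = c := Nat.ordProj_mul_ordCompl_eq_self c p
    have hw0 : w ≠ 0 := by
      rw [hw]; exact (Nat.Prime.factorization_pos_of_dvd hp hc0 hpc).ne'
    have hvpos : 0 < v := Nat.ordCompl_pos p hc0
    have hvd : v ∣ c := Nat.ordCompl_dvd c p
    have hpv : ¬ p ∣ v := Nat.not_dvd_ordCompl hp hc0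
    have hvD : ∀ t ∈ D, ¬ t ∣ v := by
      intro t ht htv
      rw [hDuniq t ht p hpD] at htv
      exact hpv htv
    have hb4 : ∀ t ∈ b.primeFactors, b.factorization t ≤ 4 := fiveFree b hdb hbD
    set u := ∏ q ∈ b.primeFactors.filter (fun q => ¬ b.factorization q = 4), q ^ b.factorization q with hu
    set Y := ∏ q ∈ b.primeFactors.filter (fun q => b.factorization q = 4), q with hY
    set Eb := ∏ q ∈ b.primeFactors.filter (fun q => ¬ b.factorization q = 4), q ^ (4 - b.factorization q) with hEb
    have hbsplit : b = u * Y ^ 4 := quarticThue_split hb0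
    have hule : u ≤ Eb ^ 3 := quarticThue_low_le_defect_cube hb4
    have hEbb : Eb * b = (radical b) ^ 4 := quarticThue_defect_mul hb0 hb4
    have hupos : 0 < u := Finset.prod_pos fun q hq =>
      pow_pos (Nat.pos_of_mem_primeFactors (Finset.mem_filter.mp hq).1) _
    have hYpos : 0 < Y := Finset.prod_pos fun q hq => Nat.pos_of_mem_primeFactors (Finset.mem_filter.mp hq).1
    have hradc : radical c = p * radical v := by rw [← hcv]; exact cellOne_radical_primePow_mul hp hw0 hpv
    have hale : a ≤ (radical a) ^ 4 := shallow a hda haD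
    have hvle : v ≤ (radical v) ^ 4 := shallow v (hvd.trans hdc) hvD
    have hble : b ≤ (radical b) ^ 4 := shallow b hdb hbD
    have hN1 : a * b * v * p ^ 4 ≤ R ^ 4 :=
      calc a * b * v * p ^ 4 ≤ (radical a) ^ 4 * (radical b) ^ 4 * (radical v) ^ 4 * p ^ 4 := by gcongr
        _ = (radical a * radical b * (p * radical v)) ^ 4 := by ring
        _ = R ^ 4 := by rw [← hradc, hRabc]
    have hN2 : Eb * b ≤ R ^ 4 := by
      have h1 : radical b ≤ R := by
        rw [← hRabc]
        calc radical b = 1 * radical b * 1 := by ring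
          _ ≤ radical a * radical b * radical c :=
              Nat.mul_le_mul (Nat.mul_le_mul_right _ (Nat.one_le_iff_ne_zero.mpr (by positivity)))
                (Nat.one_le_iff_ne_zero.mpr (by positivity))
      calc Eb * b = (radical b) ^ 4 := hEbb
        _ ≤ R ^ 4 := Nat.pow_le_pow_left h1 4
    refine ⟨p, w, u, v, Y, hp, hupos, hvpos, hYpos, ?_, ?_, hbsplit, hc2b, ?_, ?_⟩
    · rw [← hbsplit, hcv, hsum]
    · rw [← hbsplit, hcv]; exact hbc
    · calc a * u * v * p * b ^ 4 ≤ a * Eb ^ 3 * v * p ^ 4 * b ^ 4 := by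
            gcongr
            calc p = p ^ 1 := (pow_one p).symm
              _ ≤ p ^ 4 := Nat.pow_le_pow_right hp.pos (by norm_num)
        _ = (a * b * v * p ^ 4) * (Eb * b) ^ 3 := by ring
        _ ≤ R ^ 4 * (R ^ 4) ^ 3 := Nat.mul_le_mul hN1 (Nat.pow_le_pow_left hN2 3)
        _ = R ^ 16 := by ring
    · calc b ^ 4 = b ^ 3 * b := by ring
        _ = b ^ 3 * (u * Y ^ 4) := by rw [← hbsplit]
        _ = (u * b ^ 3) * Y ^ 4 := by ring
        _ ≤ (Eb * b) ^ 3 * Y ^ 4 := by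
            apply Nat.mul_le_mul_right
            calc u * b ^ 3 ≤ Eb ^ 3 * b ^ 3 := Nat.mul_le_mul_right _ hule
              _ = (Eb * b) ^ 3 := by ring
        _ ≤ (R ^ 4) ^ 3 * Y ^ 4 := Nat.mul_le_mul_right _ (Nat.pow_le_pow_left hN2 3)
        _ = R ^ 12 * Y ^ 4 := by ring
  · -- no deep prime in `b` or `c`: `bc` is 5-free, `c² ≤ 2bc ≤ 2R⁴`
    push Not at hbD hcD
    left
    have hbcD : ∀ t ∈ D, ¬ t ∣ b * c := by
      intro t ht htbc
      rcases (Nat.Prime.dvd_mul (hDprime t ht)).mp htbc with h1 | h1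
      · exact hbD t ht h1
      · exact hcD t ht h1
    have hbcd : b * c ∣ a * b * c := ⟨a, by ring⟩
    have hbcle : b * c ≤ R ^ 4 := by
      have h1 := shallow (b * c) hbcd hbcD
      have h2 : radical (b * c) ≤ R := by
        rw [hRdef]; exact calibration_radical_le_radical_of_dvd hne hbcd
      exact h1.trans (Nat.pow_le_pow_left h2 4)
    have hc2 : c ^ 2 ≤ 2 * R ^ 4 :=
      calc c ^ 2 = c * c := by ring
        _ ≤ (2 * b) * c := Nat.mul_le_mul_right _ hc2b
        _ = 2 * (b * c) := by ring
        _ ≤ 2 * R ^ 4 := Nat.mul_le_mul_left 2 hbcle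
    by_contra hlt
    push Not at hlt
    have h' : (2 * R ^ 2) ^ 2 ≤ c ^ 2 := Nat.pow_le_pow_left hlt 2
    have hR4 : 0 < R ^ 4 := by positivity
    nlinarith

end CellOne

end Summit.ABC.ABC.Theorems.DepthCountedABC
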